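import Summits.Parity.BatemanHorn.Theses.AlmostPrimeZeros

/-!
# Normality of the almost-prime family from zero repulsion (item stmt-Parity-11294)

Route `AlmostPrimeZeros` of `BatemanHorn`, support item `NormalityFromRepulsion`
(`Summit.Parity.BatemanHorn.Theses.AlmostPrimeZeros.NormalityFromRepulsion`):
Hadamard bookkeeping → Mertens along the system → zero repulsion → local boundedness of the
normalised family `H_x(z) = x⁻¹ e^{k(1−z) log log x} S_x(z)`, `S_x(z) = Σ_{n ≤ x} z^{s_f(n)}`, on the
thin rectangle `V_η = {−η < Re z < 7/4, |Im z| < η}` with `η = 1/4`.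

Proof (as on the route card).  For `x ≥ 2` apply the Hadamard inequality to the almost-prime
polynomial `P_x = Σ_{n ≤ x} X^{s_f(n)} ∈ ℂ[X]`: `P_x(1) = x + 1 ≠ 0`, `P_x'(1)/P_x(1) = μ(x)` is the
(real) mean of `s_f`, and `‖e^{k(1−z)L}‖ = e^{k(1 − Re z)L}` (`L = log log x`), so
`‖H_x(z)‖ ≤ x⁻¹(x+1) · exp((1 − Re z)(kL − μ(x)) + ½‖1 − z‖² T_f(x)) ≤ 2 exp(2 C_M + (5/2)|C_T|)`
on `V_{1/4}` (where `|1 − Re z| ≤ 2` and `‖1 − z‖² ≤ 5`), `C_M` the Mertens constant and `C_T` the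
repulsion constant of the system.  For `x < 2` the crude bound
`‖H_x(z)‖ ≤ exp(2k|log log x|) Σ_{n ≤ x} 2^{s_f(n)}` (from `‖x⁻¹‖ ≤ 1`, `‖z‖ ≤ 2`) is a constant.
The bound `M` is uniform in the centre `a`, and the radius is `r = 1`.

All lemmas are stated for an arbitrary exponent sequence `e : ℕ → ℕ`; the deciding theorem
specialises `e n = s_f(n) = Σ_i Σ_{p^v ∥ f_i(n)} min(v, 2)`.
-/

noncomputable section

namespace Summit.Parity.BatemanHorn.Theorems.AlmostPrimeZerosNormality

open Polynomial Finset

/-- `P(z) = Σ_{n ∈ s} z^{e n}` for the exponent polynomial `P = Σ_{n ∈ s} X^{e n}`. -/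
theorem eval_sum_X_pow (s : Finset ℕ) (e : ℕ → ℕ) (z : ℂ) :
    (∑ n ∈ s, (X : ℂ[X]) ^ (e n)).eval z = ∑ n ∈ s, z ^ (e n) := by
  simp only [eval_finsetSum, eval_pow, eval_X]

/-- `P(1) = #s` for the exponent polynomial `P = Σ_{n ∈ s} X^{e n}`. -/
theorem eval_one_sum_X_pow (s : Finset ℕ) (e : ℕ → ℕ) :
    (∑ n ∈ s, (X : ℂ[X]) ^ (e n)).eval 1 = (s.card : ℂ) := by
  simp [eval_finsetSum]

/-- `P'(1) = Σ_{n ∈ s} e n` for the exponent polynomial `P = Σ_{n ∈ s} X^{e n}`. -/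
theorem derivative_eval_one_sum_X_pow (s : Finset ℕ) (e : ℕ → ℕ) :
    (derivative (∑ n ∈ s, (X : ℂ[X]) ^ (e n))).eval 1 = ∑ n ∈ s, (e n : ℂ) := by
  simp [derivative_X_pow, eval_finsetSum]

/-- `Re (k (1 − z) L) = k (1 − Re z) L` for real `L` and natural `k`. -/
theorem re_natCast_mul_one_sub_mul_ofReal (k : ℕ) (z : ℂ) (L : ℝ) :
    ((k : ℂ) * (1 - z) * (L : ℂ)).re = k * (1 - z.re) * L := by
  simp [Complex.mul_re, Complex.mul_im]

/-- The norm of the normalising exponential: `‖exp(k(1−z)L)‖ = exp(k (1 − Re z) L)`. -/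
theorem norm_exp_normaliser (k : ℕ) (z : ℂ) (L : ℝ) :
    ‖Complex.exp ((k : ℂ) * (1 - z) * (L : ℂ))‖ = Real.exp (k * (1 - z.re) * L) := by
  rw [Complex.norm_exp, re_natCast_mul_one_sub_mul_ofReal]

/-- Crude bound, used for `x < 2`: for `‖z‖ ≤ 2` and `|1 − Re z| ≤ 2`,
`‖x⁻¹ e^{k(1−z)L} Σ_{n ≤ x} z^{e n}‖ ≤ exp(2k|L|) Σ_{n ≤ x} 2^{e n}` (`L = log log x`). -/
theorem norm_H_le_crude (e : ℕ → ℕ) (k x : ℕ) (z : ℂ) (hz : ‖z‖ ≤ 2) (hre : |1 - z.re| ≤ 2) :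
    ‖(x : ℂ)⁻¹ * Complex.exp ((k : ℂ) * (1 - z) * (Real.log (Real.log x) : ℂ)) *
        ∑ n ∈ range (x + 1), z ^ (e n)‖ ≤
      Real.exp (2 * k * |Real.log (Real.log x)|) * ∑ n ∈ range (x + 1), (2 : ℝ) ^ (e n) := by
  set L : ℝ := Real.log (Real.log x)
  rw [norm_mul, norm_mul, norm_exp_normaliser]
  have h1 : ‖(x : ℂ)⁻¹‖ ≤ 1 := by
    rw [norm_inv, Complex.norm_natCast]
    exact Nat.cast_inv_le_one x
  have h2 : Real.exp (k * (1 - z.re) * L) ≤ Real.exp (2 * k * |L|) := by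
    refine Real.exp_le_exp.mpr ?_
    calc (k : ℝ) * (1 - z.re) * L ≤ |(k : ℝ) * (1 - z.re) * L| := le_abs_self _
      _ = (k : ℝ) * (|1 - z.re| * |L|) := by
          rw [abs_mul, abs_mul, Nat.abs_cast, mul_assoc]
      _ ≤ (k : ℝ) * (2 * |L|) := by
          refine mul_le_mul_of_nonneg_left ?_ (Nat.cast_nonneg k)
          exact mul_le_mul_of_nonneg_right hre (abs_nonneg L)
      _ = 2 * k * |L| := by ring
  have h3 : ‖∑ n ∈ range (x + 1), z ^ (e n)‖ ≤ ∑ n ∈ range (x + 1), (2 : ℝ) ^ (e n) := by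
    refine (norm_sum_le _ _).trans (sum_le_sum fun n _ => ?_)
    rw [norm_pow]
    exact pow_le_pow_left₀ (norm_nonneg z) hz (e n)
  have h4 : 0 ≤ ∑ n ∈ range (x + 1), (2 : ℝ) ^ (e n) := sum_nonneg fun n _ => by positivity
  calc ‖(x : ℂ)⁻¹‖ * Real.exp (k * (1 - z.re) * L) * ‖∑ n ∈ range (x + 1), z ^ (e n)‖
      ≤ 1 * Real.exp (2 * k * |L|) * ∑ n ∈ range (x + 1), (2 : ℝ) ^ (e n) := by
        refine mul_le_mul (mul_le_mul h1 h2 (Real.exp_nonneg _) zero_le_one) h3 (norm_nonneg _) ?_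
        positivity
    _ = Real.exp (2 * k * |L|) * ∑ n ∈ range (x + 1), (2 : ℝ) ^ (e n) := by rw [one_mul]

/-- Main bound, used for `x ≥ 2` (stated for `x ≥ 1`): the Hadamard inequality at the exponent
polynomial `P_x = Σ_{n ≤ x} X^{e n}` (`P_x(1) = x+1`, `P_x'(1)/P_x(1) = μ` the mean of `e`), the
Mertens-type bound `|μ − k log log x| ≤ C_M` and the repulsion bound `T ≤ C_T` give
`‖x⁻¹ e^{k(1−z)L} Σ_{n ≤ x} z^{e n}‖ ≤ 2 exp(2 C_M + (5/2)|C_T|)` whenever `|1 − Re z| ≤ 2` and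
`‖1 − z‖² ≤ 5`. -/
theorem norm_H_le_of_hadamard
    (hH : ∀ P : Polynomial ℂ, P.eval 1 ≠ 0 → ∀ z : ℂ, ‖P.eval z‖ ≤ ‖P.eval 1‖ *
      Real.exp (-((1 - z) * ((Polynomial.derivative P).eval 1 / P.eval 1)).re +
        (1 / 2) * ‖1 - z‖ ^ 2 * (P.roots.map (fun ρ : ℂ => (‖(1 : ℂ) - ρ‖ ^ 2)⁻¹)).sum))
    (e : ℕ → ℕ) (k x : ℕ) (hx : 1 ≤ x) {CM CT : ℝ}
    (hM : |((∑ n ∈ range (x + 1), e n : ℕ) : ℝ) / ((x : ℝ) + 1) - (k : ℝ) * Real.log (Real.log x)|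
      ≤ CM)
    (hT : ((∑ n ∈ range (x + 1), (X : ℂ[X]) ^ (e n)).roots.map
      (fun ρ : ℂ => (‖(1 : ℂ) - ρ‖ ^ 2)⁻¹)).sum ≤ CT)
    (z : ℂ) (hre : |1 - z.re| ≤ 2) (hz2 : ‖1 - z‖ ^ 2 ≤ 5) :
    ‖(x : ℂ)⁻¹ * Complex.exp ((k : ℂ) * (1 - z) * (Real.log (Real.log x) : ℂ)) *
        ∑ n ∈ range (x + 1), z ^ (e n)‖ ≤ 2 * Real.exp (2 * CM + 5 / 2 * |CT|) := by
  set P : ℂ[X] := ∑ n ∈ range (x + 1), (X : ℂ[X]) ^ (e n) with hP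
  set L : ℝ := Real.log (Real.log x) with hL
  set S : ℕ := ∑ n ∈ range (x + 1), e n with hS
  set μ : ℝ := (S : ℝ) / ((x : ℝ) + 1) with hμ
  set T : ℝ := (P.roots.map (fun ρ : ℂ => (‖(1 : ℂ) - ρ‖ ^ 2)⁻¹)).sum with hTdef
  have hP1 : P.eval 1 = ((x + 1 : ℕ) : ℂ) := by
    rw [hP, eval_one_sum_X_pow, card_range]
  have hP1ne : P.eval 1 ≠ 0 := by
    rw [hP1]; exact_mod_cast Nat.succ_ne_zero x
  have hnormP1 : ‖P.eval 1‖ = (x : ℝ) + 1 := by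
    rw [hP1, Complex.norm_natCast]; push_cast; ring
  have hquot : (derivative P).eval 1 / P.eval 1 = (μ : ℂ) := by
    rw [hP, derivative_eval_one_sum_X_pow, ← hP, hP1, hμ, hS]
    push_cast
    ring
  have hre_eq : ((1 - z) * ((derivative P).eval 1 / P.eval 1)).re = (1 - z.re) * μ := by
    rw [hquot]; simp [Complex.mul_re]
  have hPz : P.eval z = ∑ n ∈ range (x + 1), z ^ (e n) := by
    rw [hP, eval_sum_X_pow]
  -- the Hadamard inequality at `P`, `z`
  have hHad : ‖∑ n ∈ range (x + 1), z ^ (e n)‖ ≤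
      ((x : ℝ) + 1) * Real.exp (-((1 - z.re) * μ) + 1 / 2 * ‖1 - z‖ ^ 2 * T) := by
    have h := hH P hP1ne z
    rw [hPz, hnormP1, hre_eq] at h
    exact h
  -- bookkeeping of the exponent
  have hM' : |(k : ℝ) * L - μ| ≤ CM := by
    rw [abs_sub_comm]; simpa [hμ, hS, hL] using hM
  have h1 : (1 - z.re) * ((k : ℝ) * L - μ) ≤ 2 * CM :=
    calc (1 - z.re) * ((k : ℝ) * L - μ) ≤ |(1 - z.re) * ((k : ℝ) * L - μ)| := le_abs_self _
      _ = |1 - z.re| * |(k : ℝ) * L - μ| := abs_mul _ _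
      _ ≤ 2 * CM := mul_le_mul hre hM' (abs_nonneg _) zero_le_two
  have h2 : 1 / 2 * ‖1 - z‖ ^ 2 * T ≤ 5 / 2 * |CT| := by
    have hT' : T ≤ |CT| := hT.trans (le_abs_self CT)
    have h0 : 0 ≤ ‖1 - z‖ ^ 2 := by positivity
    nlinarith [abs_nonneg CT]
  have hexp : (k : ℝ) * (1 - z.re) * L + (-((1 - z.re) * μ) + 1 / 2 * ‖1 - z‖ ^ 2 * T) ≤
      2 * CM + 5 / 2 * |CT| := by nlinarith [h1, h2]
  have hx0 : (0 : ℝ) < x := by exact_mod_cast hx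
  have hxx : (x : ℝ)⁻¹ * ((x : ℝ) + 1) ≤ 2 := by
    rw [inv_mul_le_iff₀ hx0]
    have : (1 : ℝ) ≤ x := by exact_mod_cast hx
    linarith
  rw [norm_mul, norm_mul, norm_exp_normaliser, norm_inv, Complex.norm_natCast]
  calc (x : ℝ)⁻¹ * Real.exp ((k : ℝ) * (1 - z.re) * L) * ‖∑ n ∈ range (x + 1), z ^ (e n)‖
      ≤ (x : ℝ)⁻¹ * Real.exp ((k : ℝ) * (1 - z.re) * L) *
          (((x : ℝ) + 1) * Real.exp (-((1 - z.re) * μ) + 1 / 2 * ‖1 - z‖ ^ 2 * T)) :=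
        mul_le_mul_of_nonneg_left hHad (by positivity)
    _ = (x : ℝ)⁻¹ * ((x : ℝ) + 1) *
          Real.exp ((k : ℝ) * (1 - z.re) * L + (-((1 - z.re) * μ) + 1 / 2 * ‖1 - z‖ ^ 2 * T)) := by
        simp only [Real.exp_add]; ring
    _ ≤ 2 * Real.exp (2 * CM + 5 / 2 * |CT|) :=
        mul_le_mul hxx (Real.exp_le_exp.mpr hexp) (Real.exp_nonneg _) zero_le_two

/-- Geometry of the rectangle `V_{1/4} = {−1/4 < Re z < 7/4, |Im z| < 1/4}`:
`|1 − Re z| ≤ 2`, `‖1 − z‖² ≤ 5` and `‖z‖ ≤ 2` there. -/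
theorem rect_bounds {z : ℂ} (h1 : -(1 / 4 : ℝ) < z.re) (h2 : z.re < 7 / 4) (h3 : |z.im| < 1 / 4) :
    |1 - z.re| ≤ 2 ∧ ‖1 - z‖ ^ 2 ≤ 5 ∧ ‖z‖ ≤ 2 := by
  obtain ⟨hi1, hi2⟩ := abs_lt.mp h3
  refine ⟨abs_le.mpr ⟨by linarith, by linarith⟩, ?_, ?_⟩
  · rw [Complex.sq_norm, Complex.normSq_apply]
    simp only [Complex.sub_re, Complex.one_re, Complex.sub_im, Complex.one_im, zero_sub]
    nlinarith
  · refine (Complex.norm_le_abs_re_add_abs_im z).trans ?_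
    have hr : |z.re| ≤ 7 / 4 := abs_le.mpr ⟨by linarith, by linarith⟩
    linarith [h3.le]

/-- **Item stmt-Parity-11294** (`NormalityFromRepulsion`, route `AlmostPrimeZeros`): Hadamard
bookkeeping, Mertens along the system and zero repulsion imply that for every Bateman–Horn system
the normalised almost-prime family `H_x(z) = x⁻¹ e^{k(1−z) log log x} Σ_{n ≤ x} z^{s_f(n)}` is
locally bounded on `V_η` with `η = 1/4` (radius `1`, bound uniform in the centre):
`M = 2 exp(2 C_M + (5/2)|C_T|) + Σ_{x < 2} exp(2k|log log x|) Σ_{n ≤ x} 2^{s_f(n)}`. -/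
theorem normalityFromRepulsion_proof :
    Summit.Parity.BatemanHorn.Theses.AlmostPrimeZeros.NormalityFromRepulsion := by
  intro hH hM hZ k f hf
  obtain ⟨CM, hCM⟩ := hM k f hf
  obtain ⟨CT, hCT⟩ := hZ k f hf
  refine ⟨1 / 4, by norm_num, le_rfl, ?_⟩
  intro a _
  -- the exponent sequence `s_f`
  let e : ℕ → ℕ := fun n => ∑ i, (((f i).eval (n : ℤ)).toNat.factorization.sum fun _ v => min v 2)
  -- the crude bound for a single `x`
  let B : ℕ → ℝ := fun x =>
    Real.exp (2 * k * |Real.log (Real.log x)|) * ∑ n ∈ range (x + 1), (2 : ℝ) ^ (e n)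
  have hB0 : ∀ x, 0 ≤ B x := fun x =>
    mul_nonneg (Real.exp_nonneg _) (sum_nonneg fun n _ => by positivity)
  refine ⟨2 * Real.exp (2 * CM + 5 / 2 * |CT|) + ∑ x ∈ range 2, B x, 1, one_pos, ?_⟩
  intro x z hz
  obtain ⟨h1, h2, h3⟩ := hz.2
  obtain ⟨hre, hz2, hz⟩ := rect_bounds h1 h2 h3
  rcases lt_or_ge x 2 with hx | hx
  · calc ‖(x : ℂ)⁻¹ * Complex.exp ((k : ℂ) * (1 - z) * (Real.log (Real.log x) : ℂ)) *
          ∑ n ∈ range (x + 1), z ^ (e n)‖ ≤ B x := norm_H_le_crude e k x z hz hre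
      _ ≤ ∑ x ∈ range 2, B x :=
          single_le_sum (f := B) (fun x _ => hB0 x) (mem_range.mpr hx)
      _ ≤ 2 * Real.exp (2 * CM + 5 / 2 * |CT|) + ∑ x ∈ range 2, B x :=
          le_add_of_nonneg_left (by positivity)
  · calc ‖(x : ℂ)⁻¹ * Complex.exp ((k : ℂ) * (1 - z) * (Real.log (Real.log x) : ℂ)) *
          ∑ n ∈ range (x + 1), z ^ (e n)‖ ≤ 2 * Real.exp (2 * CM + 5 / 2 * |CT|) :=
          norm_H_le_of_hadamard hH e k x (by omega) (hCM x hx) (hCT x hx) z hre hz2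
      _ ≤ 2 * Real.exp (2 * CM + 5 / 2 * |CT|) + ∑ x ∈ range 2, B x :=
          le_add_of_nonneg_right (sum_nonneg fun x _ => hB0 x)

end Summit.Parity.BatemanHorn.Theorems.AlmostPrimeZerosNormality
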